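import Summits.CriticalPhenomena.PercolationContinuityZ3.Theorems.PercNearOneGluingNoHeavyLowerTailKNGoodHairTools
import Literature.Probability.Percolation.KozmaNitzanLemma3iCluster
import Summits.CriticalPhenomena.PercolationContinuityZ3.Theorems.PercNearOneGluingAdditiveGluingKnThm2GoodEvents
import HarnessLib

/-!
# GAIN LEMMAS for pair gluing: a bystander relay gains at most what the lonelier glued relay gains
# (`NoHeavyLowerTail` cell, stmt-CriticalPhenomena-4575; prover `prim-hp-2`, goodness line, gen 15)

Support file (`--supports stmt-CriticalPhenomena-4575`).  No definitions, no named facts, no sorries.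
`μ_w = prodBernoulli w` on `Fin n`; `w[e ↦ 1]` is `Function.update w e 1` (the pair `e` glued).

For a core `C` with relays labelled by `s₁ ≤ s₂ ≤ s₃` (`s_a = μ(a ↔ b)`), the five differences
`α = s₂−s₁, β = s₃−s₂, γ = s₁₃ − t₂, δ = s₂₃ − t₁, ε = s₁₂ − t₃` (`s_{aa'} = μ_{C/aa'}([aa'] ↔ b)`, `t_c = μ_{C/aa'}(c ↔ b)`)
carry every `|A| = 3` goodness certificate of this line (MEMO-gen12 §6, MEMO-gen15 §2).  Besides `α, β, γ, δ ≥ 0` (order and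
Kozma–Nitzan Lemma 3(ii)) two further linear inequalities hold: **`δ ≥ α`** and **`ε ≥ −β`**.  Both say that when two relays
`p, q` are glued, a bystander `c` gains at most what `p` gains, provided `p` is at most as connected as `q` (first form) or as
`c` (second form); both follow from one exchange inequality, Kozma–Nitzan Lemma 3(i) with the increasing event `{x ↔ y}` minus
the common part.

* `KNGoodGain.conn_exchange` — `μ(p b) ≤ μ(x b)` ⟹ `μ(p b, x ↔ y, x ↮ b) ≤ μ(x b, x ↔ y, p ↮ b)`.
* `KNGoodGain.preimage_insert_openConn_self` / `preimage_insert_openConn_bystander_subset` — what opening the pair `s(p,q)` does to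
  `{p ↔ b}` (it becomes `{p ↔ b} ∪ {q ↔ b}`) and to a bystander's `{c ↔ b}`.
* `KNGoodGain.gain_bystander_le_of_exchange` — the common skeleton; `KNGoodGain.gain_bystander_le_of_le_partner` (**`δ ≥ α`**:
  hypothesis `μ(p b) ≤ μ(q b)`) and `KNGoodGain.gain_bystander_le_of_le_bystander` (**`ε ≥ −β`**: hypothesis `μ(p b) ≤ μ(c b)`):
  `μ_{w[s(p,q)↦1]}(c b) − μ_w(c b) ≤ μ_{w[s(p,q)↦1]}(p b) − μ_w(p b)`.
[cite: KozmaNitzan2024, Lemma 3(i) (pp. 6–7), Lemma 5 (p. 13)] [cite: VandenbergHaggstromKahn2005, Thm. 1.3 (p. 5)]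
-/

noncomputable section

namespace Summit.CriticalPhenomena.PercolationContinuityZ3.Theorems

open MeasureTheory Set Literature.Probability.LatticeModels Literature.Probability.Percolation
open scoped Classical BigOperators

variable {n : ℕ}

namespace KNGoodGain

open ChampionStability

/-- **Exchange inequality** (Kozma–Nitzan Lemma 3(i) with the increasing event `{x ↔ y}` of the cluster of `x`, the common event
`{p ↔ b, x ↔ b, x ↔ y}` removed from both sides): if `μ(p ↔ b) ≤ μ(x ↔ b)` then
`μ(p ↔ b, x ↔ y, x ↮ b) ≤ μ(x ↔ b, x ↔ y, p ↮ b)`. [cite: KozmaNitzan2024, Lemma 3(i) (pp. 6–7)] -/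
theorem conn_exchange (w : Sym2 (Fin n) → unitInterval) (p x y b : Fin n)
    (h : (prodBernoulli w).real (openConn p b) ≤ (prodBernoulli w).real (openConn x b)) :
    (prodBernoulli w).real (openConn p b ∩ openConn x y ∩ (openConn x b : Set (BondConfig (Fin n)))ᶜ) ≤
      (prodBernoulli w).real (openConn x b ∩ openConn x y ∩ (openConn p b : Set (BondConfig (Fin n)))ᶜ) := by
  haveI : IsProbabilityMeasure (prodBernoulli w) := inferInstance
  set μ := prodBernoulli w with hμ
  have e1 : ∀ a : Fin n, {ω : BondConfig (Fin n) | b ∈ openCluster ω a} = openConn a b := fun a => rfl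
  have e2 : {ω : BondConfig (Fin n) | ∃ u ∈ ({y} : Set (Fin n)), (openGraph ω).Reachable x u} = openConn x y := by
    ext ω
    simp only [mem_setOf_eq, mem_singleton_iff, exists_eq_left, knThm2_mem_openConn]
  have key := KozmaNitzan2024_lemma3_i_cluster_conn w p x (fun S => b ∈ S) (fun S T hST hb => hST hb) ({y} : Set (Fin n))
    (by rw [e1, e1]; exact h)
  rw [e1, e1, e2] at key
  have hs1 := measureReal_inter_add_sdiff (μ := μ) (s := openConn p b ∩ openConn x y)
    (t := (openConn x b : Set (BondConfig (Fin n)))) MeasurableSet.of_discrete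
  have hs2 := measureReal_inter_add_sdiff (μ := μ) (s := openConn x b ∩ openConn x y)
    (t := (openConn p b : Set (BondConfig (Fin n)))) MeasurableSet.of_discrete
  have hcomm : openConn p b ∩ openConn x y ∩ openConn x b = openConn x b ∩ openConn x y ∩ (openConn p b : Set (BondConfig (Fin n))) := by
    ext ω
    simp only [mem_inter_iff]
    tauto
  rw [Set.sdiff_eq] at hs1 hs2
  rw [hcomm] at hs1
  linarith

/-- Opening the pair `s(p,q)`: `p ↔ b` afterwards iff `p ↔ b` or `q ↔ b` before. [folklore] -/
theorem preimage_insert_openConn_self {p q : Fin n} (hpq : p ≠ q) (b : Fin n) :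
    (fun ω : BondConfig (Fin n) => insert s(p, q) ω) ⁻¹' (openConn p b : Set (BondConfig (Fin n))) =
      openConn p b ∪ openConn q b := by
  ext ω
  simp only [mem_preimage, mem_union, knThm2_mem_openConn]
  rw [reachable_insert_iff ω hpq]
  constructor
  · rintro (h | ⟨-, ⟨s, hs, hsb⟩⟩)
    · exact Or.inl h
    · simp only [Finset.mem_insert, Finset.mem_singleton] at hs
      rcases hs with rfl | rfl
      · exact Or.inl hsb
      · exact Or.inr hsb
  · rintro (h | h)
    · exact Or.inl h
    · exact Or.inr ⟨⟨p, by simp, SimpleGraph.Reachable.refl p⟩, ⟨q, by simp, h⟩⟩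

/-- Opening the pair `s(p,q)`, a bystander `c` is joined to `b` afterwards only if it was before, or `c ↔ p, p ↮ b, q ↔ b`, or
`c ↮ p, q ↔ c, q ↮ b, p ↔ b` before. [folklore] -/
theorem preimage_insert_openConn_bystander_subset {p q : Fin n} (hpq : p ≠ q) (c b : Fin n) :
    (fun ω : BondConfig (Fin n) => insert s(p, q) ω) ⁻¹' (openConn c b : Set (BondConfig (Fin n))) ⊆
      openConn c b ∪
        ((openConn q b ∩ (openConn p b : Set (BondConfig (Fin n)))ᶜ ∩ openConn c p) ∪
          (openConn p b ∩ openConn q c ∩ (openConn q b : Set (BondConfig (Fin n)))ᶜ)) := by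
  intro ω hω
  simp only [mem_preimage, knThm2_mem_openConn] at hω
  rw [reachable_insert_iff ω hpq] at hω
  simp only [mem_union, mem_inter_iff, mem_compl_iff, knThm2_mem_openConn]
  by_cases hcb : (openGraph ω).Reachable c b
  · exact Or.inl hcb
  right
  rcases hω with h | ⟨⟨s, hs, hcs⟩, ⟨s', hs', hsb⟩⟩
  · exact absurd h hcb
  simp only [Finset.mem_insert, Finset.mem_singleton] at hs hs'
  by_cases hcp : (openGraph ω).Reachable c p
  · left
    have hpb : ¬ (openGraph ω).Reachable p b := fun h => hcb (hcp.trans h)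
    rcases hs' with rfl | rfl
    · exact absurd hsb hpb
    · exact ⟨⟨hsb, hpb⟩, hcp⟩
  · right
    rcases hs with rfl | rfl
    · exact absurd hcs hcp
    have hqb : ¬ (openGraph ω).Reachable s b := fun h => hcb (hcs.trans h)
    rcases hs' with rfl | rfl
    · exact ⟨⟨hsb, hcs.symm⟩, hqb⟩
    · exact absurd hsb hqb

/-- **Gain skeleton.**  If the exchange estimate `μ(p b, q ↔ c, q ↮ b) ≤ μ(q b, p ↮ b, c ↮ p)` holds, then after gluing `p` to `q`
the bystander `c` gains at most what `p` gains:
`μ_{w[s(p,q)↦1]}(c b) − μ_w(c b) ≤ μ_{w[s(p,q)↦1]}(p b) − μ_w(p b)`. [cite: KozmaNitzan2024, Lemma 5 (p. 13)] -/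
theorem gain_bystander_le_of_exchange (w : Sym2 (Fin n) → unitInterval) (p q c b : Fin n) (hpq : p ≠ q)
    (H : (prodBernoulli w).real (openConn p b ∩ openConn q c ∩ (openConn q b : Set (BondConfig (Fin n)))ᶜ) ≤
      (prodBernoulli w).real (openConn q b ∩ (openConn p b : Set (BondConfig (Fin n)))ᶜ ∩
        (openConn c p : Set (BondConfig (Fin n)))ᶜ)) :
    (prodBernoulli (Function.update w s(p, q) 1)).real (openConn c b) - (prodBernoulli w).real (openConn c b) ≤
      (prodBernoulli (Function.update w s(p, q) 1)).real (openConn p b) - (prodBernoulli w).real (openConn p b) := by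
  haveI : ∀ u : Sym2 (Fin n) → unitInterval, IsProbabilityMeasure (prodBernoulli u) := fun u => inferInstance
  set μ := prodBernoulli w with hμ
  rw [tieLiftTwo_real_update_one w s(p, q) (openConn c b), tieLiftTwo_real_update_one w s(p, q) (openConn p b),
    preimage_insert_openConn_self hpq b]
  -- the gain of `p`
  have hp : μ.real (openConn p b ∪ openConn q b) =
      μ.real (openConn p b) + μ.real (openConn q b ∩ (openConn p b : Set (BondConfig (Fin n)))ᶜ) := by
    rw [← measureReal_union (μ := μ) (s₁ := openConn p b)
      (s₂ := openConn q b ∩ (openConn p b : Set (BondConfig (Fin n)))ᶜ) ?_ MeasurableSet.of_discrete]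
    · congr 1
      ext ω
      simp only [mem_union, mem_inter_iff, mem_compl_iff]
      tauto
    · exact disjoint_left.mpr fun ω h1 h2 => h2.2 h1
  -- the gain of `c`
  set E₁ : Set (BondConfig (Fin n)) := openConn q b ∩ (openConn p b : Set (BondConfig (Fin n)))ᶜ ∩ openConn c p with hE₁
  set E₂ : Set (BondConfig (Fin n)) := openConn p b ∩ openConn q c ∩ (openConn q b : Set (BondConfig (Fin n)))ᶜ with hE₂
  set E₂' : Set (BondConfig (Fin n)) := openConn q b ∩ (openConn p b : Set (BondConfig (Fin n)))ᶜ ∩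
    (openConn c p : Set (BondConfig (Fin n)))ᶜ with hE₂'
  have hc : μ.real ((fun ω : BondConfig (Fin n) => insert s(p, q) ω) ⁻¹' (openConn c b : Set (BondConfig (Fin n)))) ≤
      μ.real (openConn c b) + μ.real E₁ + μ.real E₂ := by
    calc μ.real ((fun ω : BondConfig (Fin n) => insert s(p, q) ω) ⁻¹' (openConn c b : Set (BondConfig (Fin n))))
        ≤ μ.real (openConn c b ∪ (E₁ ∪ E₂)) :=
          measureReal_mono (preimage_insert_openConn_bystander_subset hpq c b)
      _ ≤ μ.real (openConn c b) + μ.real (E₁ ∪ E₂) := measureReal_union_le _ _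
      _ ≤ μ.real (openConn c b) + (μ.real E₁ + μ.real E₂) := by
          have := measureReal_union_le (μ := μ) E₁ E₂
          linarith
      _ = μ.real (openConn c b) + μ.real E₁ + μ.real E₂ := by ring
  have hdisj : Disjoint E₁ E₂' := disjoint_left.mpr fun ω h1 h2 => h2.2 h1.2
  have hunion : μ.real (E₁ ∪ E₂') = μ.real E₁ + μ.real E₂' := measureReal_union hdisj MeasurableSet.of_discrete
  have hsub : E₁ ∪ E₂' ⊆ openConn q b ∩ (openConn p b : Set (BondConfig (Fin n)))ᶜ :=
    union_subset (fun ω h => h.1) (fun ω h => h.1)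
  have hmono := measureReal_mono (μ := μ) hsub
  rw [hunion] at hmono
  linarith

/-- **Gain lemma, first form (`δ ≥ α`).**  If `μ_w(p ↔ b) ≤ μ_w(q ↔ b)` then for every bystander `c`, gluing `p` to `q` helps `c`
at most as much as it helps `p`: `μ_{w[s(p,q)↦1]}(c b) − μ_w(c b) ≤ μ_{w[s(p,q)↦1]}(p b) − μ_w(p b)`.  With relays labelled
`s₁ ≤ s₂ ≤ s₃` and `(p,q,c) = (2,3,1)` this is `t₁ − s₁ ≤ s₂₃ − s₂`, i.e. `δ ≥ α` (MEMO-gen15 §2).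
[cite: KozmaNitzan2024, Lemma 3(i) (pp. 6–7), Lemma 5 (p. 13)] -/
theorem gain_bystander_le_of_le_partner (w : Sym2 (Fin n) → unitInterval) (p q c b : Fin n) (hpq : p ≠ q)
    (hle : (prodBernoulli w).real (openConn p b) ≤ (prodBernoulli w).real (openConn q b)) :
    (prodBernoulli (Function.update w s(p, q) 1)).real (openConn c b) - (prodBernoulli w).real (openConn c b) ≤
      (prodBernoulli (Function.update w s(p, q) 1)).real (openConn p b) - (prodBernoulli w).real (openConn p b) := by
  haveI : IsProbabilityMeasure (prodBernoulli w) := inferInstance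
  refine gain_bystander_le_of_exchange w p q c b hpq ((conn_exchange w p q c b hle).trans (measureReal_mono ?_))
  intro ω hω
  simp only [mem_inter_iff, mem_compl_iff, knThm2_mem_openConn] at hω ⊢
  obtain ⟨⟨hqb, hqc⟩, hpb⟩ := hω
  exact ⟨⟨hqb, hpb⟩, fun hcp => hpb (hcp.symm.trans (hqc.symm.trans hqb))⟩

/-- **Gain lemma, second form (`ε ≥ −β`).**  If `μ_w(p ↔ b) ≤ μ_w(c ↔ b)` then gluing `p` to `q` helps the bystander `c` at most
as much as it helps `p`: `μ_{w[s(p,q)↦1]}(c b) − μ_w(c b) ≤ μ_{w[s(p,q)↦1]}(p b) − μ_w(p b)`.  With relays labelled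
`s₁ ≤ s₂ ≤ s₃` and `(p,q,c) = (2,1,3)` this is `t₃ − s₃ ≤ s₁₂ − s₂`, i.e. `ε ≥ −β` (MEMO-gen15 §2).
[cite: KozmaNitzan2024, Lemma 3(i) (pp. 6–7), Lemma 5 (p. 13)] -/
theorem gain_bystander_le_of_le_bystander (w : Sym2 (Fin n) → unitInterval) (p q c b : Fin n) (hpq : p ≠ q)
    (hle : (prodBernoulli w).real (openConn p b) ≤ (prodBernoulli w).real (openConn c b)) :
    (prodBernoulli (Function.update w s(p, q) 1)).real (openConn c b) - (prodBernoulli w).real (openConn c b) ≤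
      (prodBernoulli (Function.update w s(p, q) 1)).real (openConn p b) - (prodBernoulli w).real (openConn p b) := by
  haveI : IsProbabilityMeasure (prodBernoulli w) := inferInstance
  have key := conn_exchange w p c q b hle
  have hE : (openConn p b ∩ openConn q c ∩ (openConn q b : Set (BondConfig (Fin n)))ᶜ) =
      openConn p b ∩ openConn c q ∩ (openConn c b : Set (BondConfig (Fin n)))ᶜ := by
    ext ω
    simp only [mem_inter_iff, mem_compl_iff, knThm2_mem_openConn]
    constructor
    · rintro ⟨⟨hpb, hqc⟩, hqb⟩
      exact ⟨⟨hpb, hqc.symm⟩, fun hcb => hqb (hqc.trans hcb)⟩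
    · rintro ⟨⟨hpb, hcq⟩, hcb⟩
      exact ⟨⟨hpb, hcq.symm⟩, fun hqb => hcb (hcq.trans hqb)⟩
  refine gain_bystander_le_of_exchange w p q c b hpq ?_
  rw [hE]
  refine key.trans (measureReal_mono ?_)
  intro ω hω
  simp only [mem_inter_iff, mem_compl_iff, knThm2_mem_openConn] at hω ⊢
  obtain ⟨⟨hcb, hcq⟩, hpb⟩ := hω
  exact ⟨⟨hcq.symm.trans hcb, hpb⟩, fun hcp => hpb (hcp.symm.trans hcb)⟩

end KNGoodGain

end Summit.CriticalPhenomena.PercolationContinuityZ3.Theorems
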